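import Mathlib
import Summits.Ventures.LatticeQCDFlow.Scaling.GroupLayerHaar
import Summits.Ventures.LatticeQCDFlow.TrivializingMaps.UNHaarTraceMoments
import Literature.MathematicalPhysics.QuantumLattice.GaugeGroupsProofs

/-!
# LatticeQCDFlow / Scaling — the ONE-LINK DATA of the fundamental representation of `U(N)`:
# `∫ |tr g|² dg = 1`, `∫ (tr g)² dg = 0`, `∫ Re tr g · g_{ab} dg = δ_{ab}/(2N)`, `θ = 1/(2N)`, EVERY `N ≥ 1`

HONEST FRAMING: exact (Metropolis-corrected) sampling algorithms for lattice gauge theory;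
figures of merit are autocorrelation/cost numbers at stated couplings and volumes; no
continuum-physics claim.

Venture `LatticeQCDFlow` (cell pub-lqcd), topic `Scaling`, FANOUT row 30 (lean-1 GEN-12) — OUR WORK.
Gen-10 made the slab-chain proof of (LC)/(U′) group-generic: the only input about the gauge group is
the one-link data `GroupLayer.OneLink ρ θ` (`Scaling/GroupLayerHaar.lean`), discharged there for
`SU(N)` (`SUNOneLink`) and `U(1) = Circle` (`U1OneLink`), and its successor note listed `U(N)` as open.
This file DISCHARGES it for `G = U(N)` (Mathlib's `Matrix.unitaryGroup (Fin N) ℂ`, the tree's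
instances of `Literature.MathematicalPhysics.QuantumLattice.GaugeGroups`) and its defining
representation `unitaryFundamentalRep (Fin N) ℂ`, for EVERY `N ≥ 1`, with `θ = 1/(2N)` — WITHOUT
Peter–Weyl.  The trace moments (`∫ tr = 0`, `∫ (tr g)² = 0`, `∫ |tr g|² = 1`, `∫ (Re tr g)² = ½`) are
lean-2's `TrivializingMaps/UNHaarTraceMoments.lean` (GEN-9); what is added here is the matrix-valued
one-link integral, again by conjugation invariance of Haar measure under explicit unitary matrices
(a permutation matrix `Matrix.swap a b`, the diagonal sign `−1` at one slot):

* §1 `tr g⁻¹ = conj tr g`; `∫ Re tr g · g_{ab} dg = 0` for `a ≠ b` (conjugation by the sign at slot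
  `a` flips `g_{ab}` and fixes the character); `∫ Re tr g · g_{aa} dg` independent of `a`
  (conjugation by a permutation matrix); `∫ Re tr g · tr g dg = ½` (`2 Re tr = tr + conj tr` and
  lean-2's two moments), hence `∫ Re tr g · g_{aa} dg = 1/(2N)`;
* §2 **`oneLink_unitaryFundamentalRep (hN : 1 ≤ N) : OneLink (unitaryFundamentalRep (Fin N) ℂ) (1/(2N))`**
  — the input that turns `Scaling/GroupCrossCutFloorAllT.lean` / `ClusteringFloorAnyAxis.lean` into
  (LC)/(U′)/(U″) at strong coupling for `U(N)` lattice gauge theory (sequel `UNCrossCutFloor`), with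
  the tube coefficient `N θ^{4t+1} = 2^{-(4t+1)} N^{-4t}`.

Elementary; nothing is cited as a fact; no `def`, no `sorry`.  Literature grade (cell rule): known
facts (second moments of Haar measure on `U(N)`, Diaconis–Shahshahani 1994 / Weingarten), by an
invariance argument; new docking only.
-/

noncomputable section

open MeasureTheory Filter Finset Matrix
open scoped ComplexConjugate
open Literature.MathematicalPhysics.QuantumFieldTheory
open Literature.MathematicalPhysics.QuantumLattice (unitaryFundamentalRep unitaryFundamentalRep_apply
  continuous_unitaryFundamentalRep diagonal_mem_unitaryGroup_iff)
open Summit.Ventures.LatticeQCDFlow.TrivializingMaps (integrable_haarUN_of_continuous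
  un_integral_normSq_trace un_integral_trace_sq_eq_zero un_integral_re_trace un_haarSqReTrace_eq_half)

namespace Summit.Ventures.LatticeQCDFlow.Theory2.GroupLayer

variable {N : ℕ}

/-! ## §0 An explicit unitary matrix -/

/-- The diagonal matrix with `z` (`‖z‖ = 1`) at slot `a` and `1` elsewhere is unitary. [folklore] -/
theorem diagonal_update_mem_unitaryGroup (a : Fin N) {z : ℂ} (hz : ‖z‖ = 1) :
    diagonal (Function.update (1 : Fin N → ℂ) a z) ∈ Matrix.unitaryGroup (Fin N) ℂ := by
  rw [diagonal_mem_unitaryGroup_iff]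
  intro i
  by_cases hi : i = a
  · subst hi; simpa using hz
  · simp [hi]

/-! ## §1 The one-link integrals `∫ Re tr g · g_{ab} dg` -/

/-- `Re tr` of the fundamental representation of `U(N)` is `Re tr` of the matrix. [folklore] -/
theorem trRe_unitaryFundamentalRep (g : Matrix.unitaryGroup (Fin N) ℂ) :
    trRe (unitaryFundamentalRep (Fin N) ℂ) g = ((g : Matrix (Fin N) (Fin N) ℂ)).trace.re := rfl

/-- **`tr g⁻¹ = conj tr g`** on `U(N)` (the inverse is the conjugate transpose). [folklore] -/
theorem trace_inv_U (g : Matrix.unitaryGroup (Fin N) ℂ) :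
    (unitaryFundamentalRep (Fin N) ℂ g⁻¹).trace = star (unitaryFundamentalRep (Fin N) ℂ g).trace := by
  rw [unitaryFundamentalRep_apply, unitaryFundamentalRep_apply, Matrix.UnitaryGroup.inv_val,
    star_eq_conjTranspose, trace_conjTranspose]

/-- **`∫ Re tr g · g_{ab} dg = 0` for `a ≠ b`** (conjugation by the sign `−1` at slot `a`
multiplies `g_{ab}` by `−1` and fixes the character). [folklore] -/
theorem integral_trRe_mul_entry_eq_zero_of_ne_U {a b : Fin N} (hab : a ≠ b) :
    ∫ g, (trRe (unitaryFundamentalRep (Fin N) ℂ) g : ℂ) * (g : Matrix (Fin N) (Fin N) ℂ) a b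
      ∂haarProbability (Matrix.unitaryGroup (Fin N) ℂ) = 0 := by
  set μ := haarProbability (Matrix.unitaryGroup (Fin N) ℂ) with hμ
  set D : Matrix.unitaryGroup (Fin N) ℂ := ⟨diagonal (Function.update (1 : Fin N → ℂ) a (-1)),
    diagonal_update_mem_unitaryGroup a (by simp)⟩ with hD
  have key := integral_haar_conj_eq (G := Matrix.unitaryGroup (Fin N) ℂ)
    (fun g => (trRe (unitaryFundamentalRep (Fin N) ℂ) g : ℂ) * (g : Matrix (Fin N) (Fin N) ℂ) a b) D D⁻¹
  have hda : Function.update (1 : Fin N → ℂ) a (-1) a = -1 := by simp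
  have hdb : Function.update (1 : Fin N → ℂ) a (-1) b = 1 := by simp [Ne.symm hab]
  have hentry : ∀ g : Matrix.unitaryGroup (Fin N) ℂ,
      ((D * g * D⁻¹ : Matrix.unitaryGroup (Fin N) ℂ) : Matrix (Fin N) (Fin N) ℂ) a b =
        -(g : Matrix (Fin N) (Fin N) ℂ) a b := by
    intro g
    rw [Submonoid.coe_mul, Submonoid.coe_mul, Matrix.UnitaryGroup.inv_val, hD]
    dsimp only
    rw [star_eq_conjTranspose, diagonal_conjTranspose, mul_diagonal, diagonal_mul, Pi.star_apply,
      hda, hdb, star_one]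
    ring
  have htr : ∀ g : Matrix.unitaryGroup (Fin N) ℂ,
      trRe (unitaryFundamentalRep (Fin N) ℂ) (D * g * D⁻¹) = trRe (unitaryFundamentalRep (Fin N) ℂ) g :=
    fun g => trRe_conj _ D g
  simp only [hentry, htr, mul_neg, integral_neg] at key
  have h2 : (2 : ℂ) * ∫ g, (trRe (unitaryFundamentalRep (Fin N) ℂ) g : ℂ) *
      (g : Matrix (Fin N) (Fin N) ℂ) a b ∂μ = 0 := by linear_combination -key
  exact (mul_eq_zero.1 h2).resolve_left two_ne_zero

/-- **`∫ Re tr g · g_{aa} dg` does not depend on `a`** (conjugation by the permutation matrix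
`swap a b`: `(S g S⁻¹)_{aa} = g_{bb}`). [folklore] -/
theorem integral_trRe_mul_diag_eq_U (a b : Fin N) :
    ∫ g, (trRe (unitaryFundamentalRep (Fin N) ℂ) g : ℂ) * (g : Matrix (Fin N) (Fin N) ℂ) a a
        ∂haarProbability (Matrix.unitaryGroup (Fin N) ℂ) =
      ∫ g, (trRe (unitaryFundamentalRep (Fin N) ℂ) g : ℂ) * (g : Matrix (Fin N) (Fin N) ℂ) b b
        ∂haarProbability (Matrix.unitaryGroup (Fin N) ℂ) := by
  have hSmem : Matrix.swap ℂ a b ∈ Matrix.unitaryGroup (Fin N) ℂ := by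
    rw [Matrix.mem_unitaryGroup_iff, star_eq_conjTranspose, conjTranspose_swap, swap_mul_self]
  set S : Matrix.unitaryGroup (Fin N) ℂ := ⟨Matrix.swap ℂ a b, hSmem⟩ with hS
  have key := integral_haar_conj_eq (G := Matrix.unitaryGroup (Fin N) ℂ)
    (fun g => (trRe (unitaryFundamentalRep (Fin N) ℂ) g : ℂ) * (g : Matrix (Fin N) (Fin N) ℂ) a a) S S⁻¹
  have hentry : ∀ g : Matrix.unitaryGroup (Fin N) ℂ,
      ((S * g * S⁻¹ : Matrix.unitaryGroup (Fin N) ℂ) : Matrix (Fin N) (Fin N) ℂ) a a =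
        (g : Matrix (Fin N) (Fin N) ℂ) b b := by
    intro g
    rw [Submonoid.coe_mul, Submonoid.coe_mul, Matrix.UnitaryGroup.inv_val, hS]
    dsimp only
    rw [star_eq_conjTranspose, conjTranspose_swap, Matrix.mul_swap_apply_left,
      Matrix.swap_mul_apply_left]
  have htr : ∀ g : Matrix.unitaryGroup (Fin N) ℂ,
      trRe (unitaryFundamentalRep (Fin N) ℂ) (S * g * S⁻¹) = trRe (unitaryFundamentalRep (Fin N) ℂ) g :=
    fun g => trRe_conj _ S g
  simp only [hentry, htr] at key
  exact key.symm

/-- **`∫ Re tr g · tr g dg = 1/2`** (`N ≥ 1`): `2 Re tr g · tr g = (tr g)² + |tr g|²`. [folklore] -/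
theorem integral_trRe_mul_trace_U (hN : 1 ≤ N) :
    ∫ g, (trRe (unitaryFundamentalRep (Fin N) ℂ) g : ℂ) * ((g : Matrix (Fin N) (Fin N) ℂ)).trace
      ∂haarProbability (Matrix.unitaryGroup (Fin N) ℂ) = 1 / 2 := by
  set μ := haarProbability (Matrix.unitaryGroup (Fin N) ℂ) with hμ
  have hc : Continuous fun g : Matrix.unitaryGroup (Fin N) ℂ => ((g : Matrix (Fin N) (Fin N) ℂ)).trace :=
    continuous_subtype_val.matrix_trace
  have hsum : ∀ g : Matrix.unitaryGroup (Fin N) ℂ,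
      (trRe (unitaryFundamentalRep (Fin N) ℂ) g : ℂ) * ((g : Matrix (Fin N) (Fin N) ℂ)).trace =
        2⁻¹ * ((g : Matrix (Fin N) (Fin N) ℂ)).trace ^ 2 +
          2⁻¹ * ((Complex.normSq ((g : Matrix (Fin N) (Fin N) ℂ)).trace : ℝ) : ℂ) := by
    intro g
    rw [trRe_unitaryFundamentalRep, ← Complex.mul_conj, sq]
    have h := Complex.add_conj ((g : Matrix (Fin N) (Fin N) ℂ)).trace
    have h2 : (((g : Matrix (Fin N) (Fin N) ℂ)).trace.re : ℂ) =
        2⁻¹ * (((g : Matrix (Fin N) (Fin N) ℂ)).trace + conj ((g : Matrix (Fin N) (Fin N) ℂ)).trace) := by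
      rw [h]; push_cast; ring
    rw [h2]
    ring
  have hi1 : Integrable (fun g : Matrix.unitaryGroup (Fin N) ℂ =>
      (2 : ℂ)⁻¹ * ((g : Matrix (Fin N) (Fin N) ℂ)).trace ^ 2) μ :=
    (integrable_haarUN_of_continuous (hc.pow 2)).const_mul _
  have hi2 : Integrable (fun g : Matrix.unitaryGroup (Fin N) ℂ =>
      (2 : ℂ)⁻¹ * ((Complex.normSq ((g : Matrix (Fin N) (Fin N) ℂ)).trace : ℝ) : ℂ)) μ :=
    (integrable_haarUN_of_continuous
      (Complex.continuous_ofReal.comp (Complex.continuous_normSq.comp hc))).const_mul _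
  simp_rw [hsum]
  rw [integral_add hi1 hi2, integral_const_mul, integral_const_mul, un_integral_trace_sq_eq_zero,
    integral_complex_ofReal, un_integral_normSq_trace hN]
  push_cast
  ring

/-- **`Σ_a ∫ Re tr g · g_{aa} dg = 1/2`.** [folklore] -/
theorem sum_integral_trRe_mul_diag_U (hN : 1 ≤ N) :
    ∑ a : Fin N, ∫ g, (trRe (unitaryFundamentalRep (Fin N) ℂ) g : ℂ) * (g : Matrix (Fin N) (Fin N) ℂ) a a
      ∂haarProbability (Matrix.unitaryGroup (Fin N) ℂ) = 1 / 2 := by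
  have hint : ∀ a : Fin N, Integrable (fun g : Matrix.unitaryGroup (Fin N) ℂ =>
      (trRe (unitaryFundamentalRep (Fin N) ℂ) g : ℂ) * (g : Matrix (Fin N) (Fin N) ℂ) a a)
      (haarProbability (Matrix.unitaryGroup (Fin N) ℂ)) := fun a =>
    integrable_trRe_mul_entry (continuous_unitaryFundamentalRep (Fin N) ℂ) a a
  rw [← integral_trRe_mul_trace_U hN, ← integral_finsetSum _ fun a _ => hint a]
  refine integral_congr_ae (Eventually.of_forall fun g => ?_)
  simp only [Matrix.trace, Matrix.diag, Finset.mul_sum]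

/-- **The diagonal one-link integral**: `∫ Re tr g · g_{aa} dg = 1/(2N)` (`N ≥ 1`). [folklore] -/
theorem integral_trRe_mul_diag_U (hN : 1 ≤ N) (a : Fin N) :
    ∫ g, (trRe (unitaryFundamentalRep (Fin N) ℂ) g : ℂ) * (g : Matrix (Fin N) (Fin N) ℂ) a a
      ∂haarProbability (Matrix.unitaryGroup (Fin N) ℂ) = ((1 / (2 * N) : ℝ) : ℂ) := by
  have h := sum_integral_trRe_mul_diag_U hN
  rw [Finset.sum_congr rfl fun b _ => integral_trRe_mul_diag_eq_U b a, sum_const, card_univ,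
    Fintype.card_fin, nsmul_eq_mul] at h
  have hN0 : (N : ℂ) ≠ 0 := by exact_mod_cast (show N ≠ 0 by omega)
  push_cast
  field_simp
  linear_combination (2 : ℂ) * h

/-! ## §2 The one-link data of `U(N)` -/

/-- **THE ONE-LINK DATA OF `U(N)`, EVERY `N ≥ 1`**: the defining representation is continuous,
`tr g⁻¹ = conj tr g`, `∫ Re tr = 0`, and `∫ Re tr g · g_{ab} dg = δ_{ab}/(2N)`, i.e.
`OneLink (unitaryFundamentalRep (Fin N) ℂ) (1/(2N))`. [folklore] -/
theorem oneLink_unitaryFundamentalRep (hN : 1 ≤ N) :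
    OneLink (G := Matrix.unitaryGroup (Fin N) ℂ) (unitaryFundamentalRep (Fin N) ℂ) (1 / (2 * N)) := by
  refine ⟨continuous_unitaryFundamentalRep (Fin N) ℂ, trace_inv_U, ?_, fun a b => ?_⟩
  · simp_rw [trRe_unitaryFundamentalRep]
    exact un_integral_re_trace
  · simp_rw [unitaryFundamentalRep_apply]
    by_cases hab : a = b
    · subst hab
      rw [if_pos rfl, integral_trRe_mul_diag_U hN]
    · rw [if_neg hab, integral_trRe_mul_entry_eq_zero_of_ne_U hab]

end Summit.Ventures.LatticeQCDFlow.Theory2.GroupLayer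

end
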